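import Literature.Analysis.FluidPDE.OseenDuhamelPointwiseContinuity
import Literature.Analysis.FluidPDE.NSBoundedMildSmoothing
import HarnessLib

/-!
# Joint continuity of the Duhamel term of bounded fields on the closed slab

Analysis/FluidPDE support file (everything proved; no definitions, no named facts).  For fields
`u, v` jointly (a.e. strongly) measurable and bounded by `M` on an open slab `(s, T) × E` and
`ν > 0`, the Oseen–Duhamel bilinear term `(t, x) ↦ B^ν_s(u,v)(t)(x) = oseenDuhamel ν s u v t x` is
**jointly continuous on the closed slab `[s, T] × E`** (with the value `0` at `t = s`):

* `continuousOn_uncurry_oseenDuhamel`.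

The two ingredients are already in the tree: the slices `x ↦ B^ν_s(u,v)(t)(x)` are continuous for
`s < t ≤ T` (`continuous_oseenDuhamel_slice`, dominated convergence under the kernel bound
(14) of Koch–Tataru), and `t ↦ B^ν_s(u,v)(t)(x)` has a modulus of continuity UNIFORM in `x`
(`exists_forall_norm_oseenDuhamel_sub_le`, KNSS 2009 (3.10)); a function continuous in `x` at
each time and uniformly-in-`x` continuous in time is jointly continuous.  This is the joint
continuity needed to place Duhamel terms of bounded continuous fields in spaces of bounded
continuous space–time fields (sup-norm perturbation theory of the Oseen integral equation).

## Mathlib / tree search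

Tree: `continuous_oseenDuhamel_slice` (`NSBoundedMildSmoothing.lean`),
`exists_forall_norm_oseenDuhamel_sub_le` (`OseenDuhamelPointwiseContinuity.lean`),
`oseenDuhamel_eq_zero_of_le` (`OseenBoundedFieldsContinuity.lean`).
Mathlib: `Metric.continuousWithinAt_iff`, `Metric.continuousAt_iff`.

## References

* G. Koch, N. Nadirashvili, G. Seregin, V. Šverák, Acta Math. 203 (2009) = arXiv:0709.3599,
  §3 (3.10) (parabolic Hölder continuity of the Stokes potential with bounded right-hand side).
  [KochNadirashviliSereginSverak2009]
-/

noncomputable section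

open MeasureTheory Set Function Filter Metric
open _root_.Topology

namespace Literature.Analysis.FluidPDE

variable {E : Type*} [NormedAddCommGroup E] [InnerProductSpace ℝ E] [FiniteDimensional ℝ E]
  [MeasurableSpace E] [BorelSpace E]

variable {ν s T M : ℝ} {u v : ℝ → E → E}

/-- **Joint continuity of the Duhamel term of bounded fields on the closed slab.**  For `ν > 0`
and `u, v` jointly a.e.-strongly measurable and bounded by `M` on `(s, T) × E`, the map
`(t, x) ↦ B^ν_s(u,v)(t)(x)` is continuous on `[s, T] × E`.  At a point `(t₀, x₀)`:
`‖B(t,x) − B(t₀,x₀)‖ ≤ ‖B(t,x) − B(t₀,x)‖ + ‖B(t₀,x) − B(t₀,x₀)‖`; the first term is small for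
`|t − t₀| ≤ δ` uniformly in `x` (`exists_forall_norm_oseenDuhamel_sub_le`), the second by
continuity of the slice at `t₀ > s` (`continuous_oseenDuhamel_slice`), while for `t₀ = s` the
slice vanishes identically (`oseenDuhamel_eq_zero_of_le`). [cite: KochNadirashviliSereginSverak2009, §3 (3.10)] -/
theorem continuousOn_uncurry_oseenDuhamel (hν : 0 < ν) (hM : 0 ≤ M)
    (hum : AEStronglyMeasurable (uncurry u) ((volume : Measure (ℝ × E)).restrict (Ioo s T ×ˢ univ)))
    (hvm : AEStronglyMeasurable (uncurry v) ((volume : Measure (ℝ × E)).restrict (Ioo s T ×ˢ univ)))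
    (huM : ∀ τ ∈ Ioo s T, ∀ y, ‖u τ y‖ ≤ M) (hvM : ∀ τ ∈ Ioo s T, ∀ y, ‖v τ y‖ ≤ M) :
    ContinuousOn (uncurry (oseenDuhamel ν s u v)) (Icc s T ×ˢ univ) := by
  rintro ⟨t₀, x₀⟩ ⟨ht₀, -⟩
  dsimp only at ht₀
  rw [Metric.continuousWithinAt_iff]
  intro ε hε
  -- uniform modulus in time on the slab of length `S = T - s + 1 > 0`
  obtain ⟨δ, hδ, hmod⟩ := exists_forall_norm_oseenDuhamel_sub_le (E := E) hν
    (S := T - s + 1) (by linarith [ht₀.1.trans ht₀.2]) hM (half_pos hε)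
  have hmod' : ∀ ⦃t t' : ℝ⦄, s ≤ t → t ≤ t' → t' ≤ T → t' - t ≤ δ → ∀ x,
      ‖oseenDuhamel ν s u v t' x - oseenDuhamel ν s u v t x‖ ≤ ε / 2 := fun t t' h1 h2 h3 h4 x =>
    hmod (by linarith) hum hvm huM hvM h1 h2 h3 h4 x
  -- continuity of the slice at `t₀` in `x` (trivial at `t₀ = s`)
  have hslice : ∃ η > 0, ∀ x, dist x x₀ < η →
      ‖oseenDuhamel ν s u v t₀ x - oseenDuhamel ν s u v t₀ x₀‖ < ε / 2 := by
    rcases ht₀.1.eq_or_lt with h | hst₀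
    · refine ⟨1, one_pos, fun x _ => ?_⟩
      rw [← h, oseenDuhamel_eq_zero_of_le le_rfl, oseenDuhamel_eq_zero_of_le le_rfl, sub_zero,
        norm_zero]
      exact half_pos hε
    · have hc := (continuous_oseenDuhamel_slice hν hM hum hvm huM hvM hst₀ ht₀.2).continuousAt
        (x := x₀)
      rw [Metric.continuousAt_iff] at hc
      obtain ⟨η, hη, hηc⟩ := hc (ε / 2) (half_pos hε)
      exact ⟨η, hη, fun x hx => by simpa [dist_eq_norm] using hηc hx⟩
  obtain ⟨η, hη, hηc⟩ := hslice
  refine ⟨min δ η, lt_min hδ hη, ?_⟩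
  rintro ⟨t, x⟩ ⟨ht, -⟩ hdist
  dsimp only at ht
  rw [Prod.dist_eq, max_lt_iff] at hdist
  obtain ⟨hdt, hdx⟩ := hdist
  have hdt' : |t - t₀| < δ := by
    have := hdt.trans_le (min_le_left _ _); rwa [Real.dist_eq] at this
  have hdx' : dist x x₀ < η := hdx.trans_le (min_le_right _ _)
  -- time increment, uniformly in `x`
  have htime : ‖oseenDuhamel ν s u v t x - oseenDuhamel ν s u v t₀ x‖ ≤ ε / 2 := by
    rcases le_total t t₀ with h | h
    · rw [norm_sub_rev]
      exact hmod' ht.1 h ht₀.2 (by linarith [(abs_lt.1 hdt').1]) x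
    · exact hmod' ht₀.1 h ht.2 (by linarith [(abs_lt.1 hdt').2]) x
  have hspace := hηc x hdx'
  simp only [uncurry_apply_pair]
  rw [dist_eq_norm]
  calc ‖oseenDuhamel ν s u v t x - oseenDuhamel ν s u v t₀ x₀‖
      = ‖(oseenDuhamel ν s u v t x - oseenDuhamel ν s u v t₀ x) +
          (oseenDuhamel ν s u v t₀ x - oseenDuhamel ν s u v t₀ x₀)‖ := by rw [sub_add_sub_cancel]
    _ ≤ ‖oseenDuhamel ν s u v t x - oseenDuhamel ν s u v t₀ x‖ +
          ‖oseenDuhamel ν s u v t₀ x - oseenDuhamel ν s u v t₀ x₀‖ := norm_add_le _ _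
    _ < ε / 2 + ε / 2 := add_lt_add_of_le_of_lt htime hspace
    _ = ε := by ring

end Literature.Analysis.FluidPDE

end
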